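import Literature.NumberTheory.Transcendental.KZDominatedFamily
import Literature.NumberTheory.Transcendental.KZLogCalculusProofs
import HarnessLib

/-!
# Dominated families: two special fibres differ by a relation

Sibling proof file of `Literature/NumberTheory/Transcendental/KZDominatedFamily.lean`
(definition request `defn-KZ.IsDominatedFamily`, route KontsevichZagierPeriods/ValuedFieldSpecialisation).
There the special fibre `r₀` of a dominated family `R` is shown to be unique up to null sets
(`KZ.IsDominatedFamily.ae_mem_domain_iff`, `.ae_integrand_eq`, `.value_eq`). Here we upgrade this
to the CLASS level of the Kontsevich–Zagier calculus: two special fibres `r₀`, `r₀'` of one family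
satisfy `[r₀] − [r₀'] ∈ KZ.relations` (`KZ.IsDominatedFamily.of_sub_of_mem_relations`), which is
what consistency of clause (CT3) of the route's `CTConstruction` requires.

Proof. Let `E = {x ∈ σ₀ ∩ σ₀' | f₀ x = f₀' x}`; it is `ℚ`-semialgebraic (graph elimination for
`f₀ − f₀'`, Tarski–Seidenberg: `isSemialgebraic_sep_eq`) and `σ₀ ∖ E`, `σ₀' ∖ E` are Lebesgue-null
by a.e. uniqueness. Domain additivity `σᵢ = E ∪ (σᵢ ∖ E)` together with "null domains are
relations" (`KZ.of_mem_relations_of_volume_eq_zero`, file `KZLogCalculusProofs.lean`) gives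
`[σᵢ, fᵢ] ≡ [E, fᵢ]`, and `[E, f₀] ≡ [E, f₀']` is the congruence lemma
`KZ.of_sub_of_mem_relations_of_eqOn` (integrand additivity with a zero representation).

This file is separate from `KZDominatedFamily.lean` only to keep that definition file next to
`KZCalculus.lean` in the import order (the congruence lemmas live in `KZLogCalculusProofs.lean`).

## References

* M. Kontsevich, D. Zagier, *Periods* (2001), §1.2, rule (1).
* J. Bochnak, M. Coste, M.-F. Roy, *Real Algebraic Geometry* (1998), Thm. 2.2.1, Prop. 2.2.6.
-/

noncomputable section

open MeasureTheory Set Filter MvPolynomial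
open scoped Topology

namespace Literature.NumberTheory.Transcendental

variable {n : ℕ}

/-- The equaliser `{x ∈ s | f x = f' x}` of two real `ℚ`-semialgebraic functions on `s` is
`ℚ`-semialgebraic (graph elimination for `f − f'`; Tarski–Seidenberg).
[BCR 1998, Prop. 2.2.6, Thm. 2.2.1] [cite: BochnakCosteRoy1998, Thm. 2.2.1] -/
theorem isSemialgebraic_sep_eq {s : Set (Fin n → ℝ)} {f f' : (Fin n → ℝ) → ℝ}
    (hf : IsSemialgebraicFunOn ℚ s f) (hf' : IsSemialgebraicFunOn ℚ s f') :
    Literature.ModelTheory.ExponentialFields.IsSemialgebraic ℚ {x | x ∈ s ∧ f x = f' x} := by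
  have hsub : IsSemialgebraicFunOn ℚ s (f - f') := IsSemialgebraicFunOn.sub_holds hf hf'
  have hT : Literature.ModelTheory.ExponentialFields.IsSemialgebraic ℚ
      {z : Fin (n + 1) → ℝ | z (Fin.last n) = 0} := by
    simpa using Literature.ModelTheory.ExponentialFields.isSemialgebraic_setOf_eval_eq_zero
      (k := ℚ) (R := ℝ) (X (Fin.last n))
  convert hsub.isSemialgebraic_sep_snoc_mem
    Literature.ModelTheory.ExponentialFields.tarski_seidenberg_real_holds hT using 1
  ext x
  simp [sub_eq_zero]

namespace KZ

namespace IntegralRep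

/-- Splitting off a null semialgebraic piece: if `E ⊆ σ` is `ℚ`-semialgebraic and `σ ∖ E` is
null, then `[σ, f] − [E, f] ∈ relations` (domain additivity `σ = E ∪ (σ ∖ E)`, the null piece
being a relation by `KZ.of_mem_relations_of_volume_eq_zero`).
[KZ 2001, §1.2, rule (1)] [cite: KontsevichZagier2001, §1.2 rule (1)] -/
theorem of_sub_of_restrict_mem_relations (r : IntegralRep n) {E : Set (Fin n → ℝ)}
    (hE : Literature.ModelTheory.ExponentialFields.IsSemialgebraic ℚ E) (hEr : E ⊆ r.domain)
    (hvol : volume (r.domain \ E) = 0) :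
    of r - of (r.restrict E hE hEr) ∈ relations := by
  have hdiff : Literature.ModelTheory.ExponentialFields.IsSemialgebraic ℚ (r.domain \ E) :=
    r.isSemialgebraic_domain.diff hE
  have hsub : r.domain \ E ⊆ r.domain := fun _ hx => hx.1
  have hdom : r.domain =
      (r.restrict E hE hEr).domain ∪ (r.restrict (r.domain \ E) hdiff hsub).domain := by
    ext x
    simp only [domain_restrict, mem_union, Set.mem_sdiff]
    constructor
    · intro hx
      by_cases hxE : x ∈ E
      · exact Or.inl hxE
      · exact Or.inr ⟨hx, hxE⟩
    · rintro (hx | hx)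
      · exact hEr hx
      · exact hx.1
  have hadd : of r - of (r.restrict E hE hEr) -
      of (r.restrict (r.domain \ E) hdiff hsub) ∈ domainAddRel :=
    ⟨n, r, r.restrict E hE hEr, r.restrict (r.domain \ E) hdiff hsub, hdom,
      by simp [inter_sdiff_self], fun _ _ => rfl, fun _ _ => rfl, rfl⟩
  have hN : of (r.restrict (r.domain \ E) hdiff hsub) ∈ relations :=
    of_mem_relations_of_volume_eq_zero _ hvol
  have := relations.add_mem (domainAddRel_subset_relations hadd) hN
  simpa using this

end IntegralRep

namespace IsDominatedFamily

variable {R : IntegralRep (n + 1)} {r₀ r₀' g g' : IntegralRep n}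

/-- **Two special fibres of one dominated family differ by a relation**: `[r₀] − [r₀'] ∈
KZ.relations`. With `E = {x ∈ σ₀ ∩ σ₀' | f₀ x = f₀' x}` (`ℚ`-semialgebraic by Tarski–Seidenberg),
`σ₀ ∖ E` and `σ₀' ∖ E` are null by a.e. uniqueness of the special fibre, so `[rᵢ] ≡ [E, fᵢ]`
(domain additivity, null domains being relations), and `[E, f₀] ≡ [E, f₀']` by congruence
(integrand additivity with a zero representation, `KZ.of_sub_of_mem_relations_of_eqOn`).
[KZ 2001, §1.2, rule (1)] [cite: KontsevichZagier2001, §1.2 rule (1)] -/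
theorem of_sub_of_mem_relations (h : IsDominatedFamily R r₀ g) (h' : IsDominatedFamily R r₀' g') :
    of r₀ - of r₀' ∈ relations := by
  have hAB : Literature.ModelTheory.ExponentialFields.IsSemialgebraic ℚ (r₀.domain ∩ r₀'.domain) :=
    r₀.isSemialgebraic_domain.inter r₀'.isSemialgebraic_domain
  set E : Set (Fin n → ℝ) :=
    {x | x ∈ r₀.domain ∩ r₀'.domain ∧ r₀.integrand x = r₀'.integrand x} with hE_def
  have hE : Literature.ModelTheory.ExponentialFields.IsSemialgebraic ℚ E :=
    isSemialgebraic_sep_eq (r₀.isSemialgebraicFunOn_integrand.mono inter_subset_left hAB)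
      (r₀'.isSemialgebraicFunOn_integrand.mono inter_subset_right hAB)
  have hEA : E ⊆ r₀.domain := fun x hx => hx.1.1
  have hEB : E ⊆ r₀'.domain := fun x hx => hx.1.2
  have hvolA : volume (r₀.domain \ E) = 0 := by
    rw [measure_eq_zero_iff_ae_notMem]
    filter_upwards [h.ae_mem_domain_iff h', h.ae_integrand_eq h'] with x h₁ h₂ hx
    exact hx.2 ⟨⟨hx.1, h₁.mp hx.1⟩, h₂ hx.1 (h₁.mp hx.1)⟩
  have hvolB : volume (r₀'.domain \ E) = 0 := by
    rw [measure_eq_zero_iff_ae_notMem]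
    filter_upwards [h.ae_mem_domain_iff h', h.ae_integrand_eq h'] with x h₁ h₂ hx
    exact hx.2 ⟨⟨h₁.mpr hx.1, hx.1⟩, h₂ (h₁.mpr hx.1) hx.1⟩
  have h₁ := r₀.of_sub_of_restrict_mem_relations hE hEA hvolA
  have h₂ := r₀'.of_sub_of_restrict_mem_relations hE hEB hvolB
  have h₃ : of (r₀.restrict E hE hEA) - of (r₀'.restrict E hE hEB) ∈ relations :=
    of_sub_of_mem_relations_of_eqOn rfl fun x hx => hx.2
  have : of r₀ - of r₀' = (of r₀ - of (r₀.restrict E hE hEA)) -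
      (of r₀' - of (r₀'.restrict E hE hEB)) +
      (of (r₀.restrict E hE hEA) - of (r₀'.restrict E hE hEB)) := by
    abel
  rw [this]
  exact relations.add_mem (relations.sub_mem h₁ h₂) h₃

end IsDominatedFamily

end KZ

end Literature.NumberTheory.Transcendental
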